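import Literature.Analysis.SpecialFunctions.LogSumTrapezoid
import Mathlib.Analysis.SpecialFunctions.Integrals.Basic
import HarnessLib

/-!
# `log ‖κ + t‖` along a horizontal line: monotonicity, integral, and the dip at `t = −re κ`

Topic `Literature/Analysis/SpecialFunctions`; companion of `LogSumTrapezoid.lean`. Everything
here is PROVED; no definitions, no named facts.

For a complex `κ` and real `t`, `g(t) = log ‖κ + t‖ = ½ log((re κ + t)² + (im κ)²)` is antitone
for `t ≤ −re κ` and monotone for `t ≥ −re κ` (`antitoneOn_log_norm_add`, `monotoneOn_log_norm_add`),
its integral is the real part of the complex primitive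
(`integral_log_norm_add_eq`: `∫_a^b log‖κ+x‖ dx = Re [L(κ+b) − L(κ+a)]`, `L(z) = z log z − z`),
and the unit interval around the dip costs at most a constant:
`∫_m^{m+1} log‖κ + t‖ dt ≥ −log 2 − 1` whenever `re κ + m + ½ = 0` (`integral_log_norm_add_ge`;
from `log‖κ+t‖ ≥ log|re κ + t|` a.e. and `∫_{−1/2}^{1/2} log|s| ds = −log 2 − 1`).

These are the ingredients of crude (up to `O(log n)`) upper and lower bounds for Riemann sums
`Σᵢ log‖k ± i‖` of Pochhammer blocks on lines `re k ∈ ℤ + ½` — uniform majorants for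
hypergeometric integrands away from the saddle point. Folklore.
-/

noncomputable section

open Set MeasureTheory intervalIntegral Complex

namespace Literature.Analysis.SpecialFunctions

/-! ### Monotonicity -/

/-- `‖κ + t‖² = (re κ + t)² + (im κ)²`. [folklore] -/
theorem norm_add_real_sq (κ : ℂ) (t : ℝ) : ‖κ + t‖ ^ 2 = (κ.re + t) ^ 2 + κ.im ^ 2 := by
  rw [Complex.sq_norm, Complex.normSq_apply]; simp; ring

/-- `t ↦ log ‖κ + t‖` is monotone on `[−re κ, ∞)` (`im κ ≠ 0`). [folklore] -/
theorem monotoneOn_log_norm_add {κ : ℂ} (hκ : κ.im ≠ 0) :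
    MonotoneOn (fun t : ℝ ↦ Real.log ‖κ + t‖) (Ici (-κ.re)) := by
  intro s hs t ht hst
  simp only [mem_Ici] at hs ht
  have hpos : 0 < ‖κ + s‖ := norm_pos_iff.2 fun h0 ↦ hκ (by simpa using congrArg Complex.im h0)
  refine Real.log_le_log hpos ?_
  refine le_of_sq_le_sq ?_ (norm_nonneg _)
  rw [norm_add_real_sq, norm_add_real_sq]
  nlinarith

/-- `t ↦ log ‖κ + t‖` is antitone on `(−∞, −re κ]` (`im κ ≠ 0`). [folklore] -/
theorem antitoneOn_log_norm_add {κ : ℂ} (hκ : κ.im ≠ 0) :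
    AntitoneOn (fun t : ℝ ↦ Real.log ‖κ + t‖) (Iic (-κ.re)) := by
  intro s hs t ht hst
  simp only [mem_Iic] at hs ht
  have hpos : 0 < ‖κ + t‖ := norm_pos_iff.2 fun h0 ↦ hκ (by simpa using congrArg Complex.im h0)
  refine Real.log_le_log hpos ?_
  refine le_of_sq_le_sq ?_ (norm_nonneg _)
  rw [norm_add_real_sq, norm_add_real_sq]
  nlinarith

/-! ### The integral as a real part -/

/-- Continuity of `x ↦ log(κ + x)` (`im κ ≠ 0`). [folklore] -/
theorem continuous_log_add_ofReal {κ : ℂ} (hκ : κ.im ≠ 0) :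
    Continuous fun x : ℝ ↦ Complex.log (κ + x) :=
  continuous_iff_continuousAt.2 fun x ↦ (hasDerivAt_log_add_ofReal hκ x).continuousAt

/-- **`∫_a^b log ‖κ + x‖ dx = Re [L(κ+b) − L(κ+a)]`**, `L(z) = z log z − z` (`im κ ≠ 0`). [folklore] -/
theorem integral_log_norm_add_eq {κ : ℂ} (hκ : κ.im ≠ 0) (a b : ℝ) :
    ∫ x in a..b, Real.log ‖κ + x‖ =
      (((κ + b) * log (κ + b) - (κ + b)) - ((κ + a) * log (κ + a) - (κ + a))).re := by
  rw [← integral_log_add_eq hκ a b]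
  have hint : IntervalIntegrable (fun x : ℝ ↦ Complex.log (κ + x)) volume a b :=
    (continuous_log_add_ofReal hκ).intervalIntegrable a b
  have h := (Complex.reCLM.intervalIntegral_comp_comm hint).symm
  simp only [Complex.reCLM_apply] at h
  rw [h]
  refine integral_congr fun x _ ↦ ?_
  simp only [Complex.log_re]

/-! ### The dip -/

/-- `∫_{−1/2}^{1/2} log s ds = −log 2 − 1` (Mathlib's `log` is even). [folklore] -/
theorem integral_log_half : ∫ s in (-(1 / 2 : ℝ))..(1 / 2), Real.log s = -Real.log 2 - 1 := by
  rw [integral_log, Real.log_neg_eq_log, one_div, Real.log_inv]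
  ring

/-- `log ‖κ + t‖ ≥ log |re κ + t|` for `t ≠ −re κ`. [folklore] -/
theorem log_abs_re_add_le_log_norm_add (κ : ℂ) {t : ℝ} (ht : t ≠ -κ.re) :
    Real.log |κ.re + t| ≤ Real.log ‖κ + t‖ := by
  have hpos : 0 < |κ.re + t| := abs_pos.2 fun h ↦ ht (by linarith)
  refine Real.log_le_log hpos ?_
  have := abs_re_le_norm (κ + t)
  simpa using this

/-- **The dip costs at most `log 2 + 1`**: if `im κ ≠ 0` and `re κ + m + ½ = 0` (the line
`re = −re κ` is crossed in the middle of `[m, m+1]`), then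
`−log 2 − 1 ≤ ∫_m^{m+1} log ‖κ + t‖ dt`. [folklore] -/
theorem integral_log_norm_add_ge {κ : ℂ} (hκ : κ.im ≠ 0) {m : ℝ} (hm : κ.re + m + 1 / 2 = 0) :
    -Real.log 2 - 1 ≤ ∫ t in m..(m + 1), Real.log ‖κ + t‖ := by
  -- the comparison integral
  have hcomp : ∫ t in m..(m + 1), Real.log (κ.re + t) = -Real.log 2 - 1 := by
    rw [intervalIntegral.integral_comp_add_left (fun s ↦ Real.log s) κ.re,
      show κ.re + m = -(1 / 2) by linarith, show κ.re + (m + 1) = 1 / 2 by linarith]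
    exact integral_log_half
  rw [← hcomp]
  have hcont : Continuous fun t : ℝ ↦ Real.log ‖κ + t‖ := by
    refine Continuous.log (by fun_prop) fun t ↦ ?_
    exact (norm_pos_iff.2 fun h0 ↦ hκ (by simpa using congrArg Complex.im h0)).ne'
  refine intervalIntegral.integral_mono_ae (by linarith) ?_ (hcont.intervalIntegrable _ _) ?_
  · have := (intervalIntegrable_log' (a := κ.re + m) (b := κ.re + (m + 1))).comp_add_left κ.re
    simpa using this
  · -- `log |re κ + t| ≤ log ‖κ + t‖` off the single point `t = -re κ`
    have hae : ∀ᵐ t : ℝ, t ≠ -κ.re := by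
      have : (volume : Measure ℝ) {(-κ.re)} = 0 := measure_singleton _
      exact (ae_iff.2 (by simp [this]))
    filter_upwards [hae] with t ht
    have := log_abs_re_add_le_log_norm_add κ ht
    rwa [Real.log_abs] at this

end Literature.Analysis.SpecialFunctions
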